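import Summits.BirchSwinnertonDyer.BirchSwinnertonDyer.Theorems.EdixhovenFibreFiveSevenStarredOptimalManinUnitFiveSevenHcorBlocks
import Literature.NumberTheory.Automorphic.UnboundedDenominatorsInvariantHomPrimePowerOddPGroup
import HarnessLib

set_option linter.dupNamespace false

/-!
# K★ crux `StarredOptimalManinUnitFiveSeven`, line `cdt_thm1`: the stub `stub_hcor_invariant` for all `N` with `4 ∤ N`

`HcorBlocks.cor453_invariant_form_of_odd_block_certificates` reduced the registered stub
`CdtThm1.stub_hcor_invariant` (the `SL₂(ℤ)`-invariant form of [CalegariDimitrovTang2025, Corollary 4.5.3]) for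
levels `4 ∤ N` to the ODD BLOCK CERTIFICATES at `p^e`, `e ≥ 3`, for all odd primes `p` and all finite
commutative targets of `p`-power exponent.  ALL of these certificates are now the Literature theorem
`UnboundedDenominators.block_certificate_primePow_odd` — the `p`-primary part of Beyl's theorem
`M(SL₂(ℤ/p^e)) = 0` for odd `p` ([Beyl1986]), proved in the tree by an explicit descent along central extensions
of `SL₂(ℤ/p^e)` with kernel of exponent `p` (`SL2PrimePow*Odd`) and lifted to kernels of exponent `p^a` by the
Hopf-formula argument (`CentralExtensionExponentLift`).  Hence:

* `cor453_invariant_form_of_not_four_dvd`: **for every `N ≠ 0` with `4 ∤ N`, every finite commutative `Q` and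
  every `SL₂(ℤ)`-conjugation-invariant `θ : Γ(N) → Q`, `θ` kills `Γ(12N)`**;
* `stub_hcor_invariant_of_not_four_dvd`: the same in the exact shape of the stub (`∃ M ≠ 0`; `N = 0` excluded by
  `4 ∤ N`);
* `stub_hcor_invariant_of_two_adic`: **the registered stub VERBATIM, modulo its `2`-adic case** `4 ∣ N`, `N ≠ 0`
  (the case `N = 0` is trivial since `Γ(0) = ⊥`).

The remaining `2`-adic case is genuinely different: `M(SL₂(ℤ/2^e)) = ℤ/2` for `e ≥ 2` ([Beyl1986]), so the
analogue of the odd local condition fails and the level must grow at `2` (CDT settle the base levels by machine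
computation).  K★ / the Manin-constant statement / BSD are NOT proved by this file.
-/

open scoped MatrixGroups commutatorElement

universe u

namespace Summit.BirchSwinnertonDyer.BirchSwinnertonDyer.Theorems

namespace HcorNotFourDvd

open CongruenceSubgroup Matrix.SpecialLinearGroup ModularGroup
open Literature.NumberTheory.Automorphic.UnboundedDenominators

/-- **The invariant form of CDT Cor. 4.5.3 for all levels `4 ∤ N`.**  For every `N ≠ 0` with `4 ∤ N`, every
finite commutative `Q` and every `SL₂(ℤ)`-conjugation-invariant homomorphism `θ : Γ(N) → Q`, `θ` is trivial on
`Γ(12N)`: the `HcorBlocks` reduction to odd block certificates, all of which hold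
(`block_certificate_primePow_odd`). [cite: CalegariDimitrovTang2025, Corollary 4.5.3] [cite: Beyl1986, Theorem] -/
theorem cor453_invariant_form_of_not_four_dvd {N : ℕ} (hN0 : N ≠ 0) (h4 : ¬ 4 ∣ N) (Q : Type u) [CommGroup Q]
    [Finite Q] (θ : Gamma N →* Q)
    (hθ : ∀ (g x : SL(2, ℤ)) (hx : x ∈ Gamma N) (hgx : g * x * g⁻¹ ∈ Gamma N),
      θ ⟨g * x * g⁻¹, hgx⟩ = θ ⟨x, hx⟩) :
    ∀ (x : SL(2, ℤ)) (hx : x ∈ Gamma N), x ∈ Gamma (12 * N) → θ ⟨x, hx⟩ = 1 :=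
  HcorBlocks.cor453_invariant_form_of_odd_block_certificates
    (fun p _ _ _ hp hp2 _ _ hm' Q' _ _ hQ' θ' hθ' ↦ by
      haveI : Fact p.Prime := ⟨hp⟩
      exact block_certificate_primePow_odd hp2 hm' Q' hQ' θ' hθ')
    hN0 h4 Q θ hθ

/-- **The stub `CdtThm1.stub_hcor_invariant` for all levels `N` with `4 ∤ N`**, in the stub's exact shape: an
`SL₂(ℤ)`-invariant homomorphism `θ : Γ(N) → Q` to a finite commutative group kills some `Γ(M)`, `M ≠ 0`
(namely `M = 12N`; `N ≠ 0` is forced by `4 ∤ N`). [cite: CalegariDimitrovTang2025, Corollary 4.5.3] -/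
theorem stub_hcor_invariant_of_not_four_dvd (N : ℕ) (h4 : ¬ 4 ∣ N) (Q : Type u) [CommGroup Q] [Finite Q]
    (θ : Gamma N →* Q)
    (hθ : ∀ (g x : SL(2, ℤ)) (hx : x ∈ Gamma N) (hgx : g * x * g⁻¹ ∈ Gamma N),
      θ ⟨g * x * g⁻¹, hgx⟩ = θ ⟨x, hx⟩) :
    ∃ M : ℕ, M ≠ 0 ∧ ∀ (x : SL(2, ℤ)) (hx : x ∈ Gamma N), x ∈ Gamma M → θ ⟨x, hx⟩ = 1 := by
  have hN0 : N ≠ 0 := by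
    rintro rfl
    exact h4 (dvd_zero 4)
  exact ⟨12 * N, Nat.mul_ne_zero (by norm_num) hN0, cor453_invariant_form_of_not_four_dvd hN0 h4 Q θ hθ⟩

/-- **The registered stub, verbatim, modulo its `2`-adic case.**  If for every level `N ≠ 0` with `4 ∣ N` every
`SL₂(ℤ)`-invariant homomorphism `Γ(N) → Q` (finite commutative `Q`) kills some `Γ(M)`, `M ≠ 0`, then
`CdtThm1.stub_hcor_invariant` holds as registered (levels `4 ∤ N` by `stub_hcor_invariant_of_not_four_dvd`;
`N = 0` trivially, `Γ(0) = ⊥`). [cite: CalegariDimitrovTang2025, Corollary 4.5.3] -/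
theorem stub_hcor_invariant_of_two_adic
    (h2 : ∀ (N : ℕ), N ≠ 0 → 4 ∣ N → ∀ (Q : Type) [CommGroup Q] [Finite Q] (θ : Gamma N →* Q),
      (∀ (g x : SL(2, ℤ)) (hx : x ∈ Gamma N) (hgx : g * x * g⁻¹ ∈ Gamma N),
        θ ⟨g * x * g⁻¹, hgx⟩ = θ ⟨x, hx⟩) →
      ∃ M : ℕ, M ≠ 0 ∧ ∀ (x : SL(2, ℤ)) (hx : x ∈ Gamma N), x ∈ Gamma M → θ ⟨x, hx⟩ = 1) :
    ∀ (N : ℕ) (Q : Type) [CommGroup Q] [Finite Q] (θ : Gamma N →* Q),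
      (∀ (g x : SL(2, ℤ)) (hx : x ∈ Gamma N) (hgx : g * x * g⁻¹ ∈ Gamma N),
        θ ⟨g * x * g⁻¹, hgx⟩ = θ ⟨x, hx⟩) →
      ∃ M : ℕ, M ≠ 0 ∧ ∀ (x : SL(2, ℤ)) (hx : x ∈ Gamma N), x ∈ Gamma M → θ ⟨x, hx⟩ = 1 := by
  intro N Q _ _ θ hθ
  by_cases hN0 : N = 0
  · subst hN0
    refine ⟨1, one_ne_zero, fun x hx _ ↦ ?_⟩
    have hx1 : x = 1 := by
      have h := hx
      rw [Gamma_zero_bot, Subgroup.mem_bot] at h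
      exact h
    subst hx1
    have h1 : (⟨1, hx⟩ : Gamma 0) = 1 := rfl
    rw [h1, map_one]
  by_cases h4 : 4 ∣ N
  · exact h2 N hN0 h4 Q θ hθ
  · exact stub_hcor_invariant_of_not_four_dvd N h4 Q θ hθ

end HcorNotFourDvd

end Summit.BirchSwinnertonDyer.BirchSwinnertonDyer.Theorems
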